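import Summits.HodgeConjecture.HodgeConjecture.Theorems.Ring2WeilCoverageCMFieldNormResidueSymbolsRationalPrimes
import Summits.HodgeConjecture.HodgeConjecture.Theorems.Ring2WeilCoverageCMFieldNormResidueSymbolsDegreeOnePlaces
import Summits.HodgeConjecture.HodgeConjecture.Theorems.Ring2WeilCoverageQuarticNormObstruction
import HarnessLib

/-!
# Ring 2 — Weil-family coverage, CM-field rows: THE RATIONAL PRIME RULE on the QUADRATIC carriers with a rational
  radicand — `[ℓ] ≠ [1] ⟺ (disc R | ℓ) = +1 ∧ (b₀ | ℓ) = -1` («`ℓ` splits in `F` into two places inert in `E`»)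
  (WEIL-FAMILY-COVERAGE «## b03», cell (xxi′), part 14)

research route conditional on HC_CM; not a corollary; Q11.4-sentence-2 already refuted in dim ≥ 3.

Deligne's quadratic carriers `R = S² + pS + q` present a quartic CM field `E = ℚ[T]/(R(T²)) = F(√θ)` over the real
quadratic field `F = ℚ[S]/(R) = ℚ(θ)` [cite: Deligne1982HodgeCycles, §4 p. 30]; the rows `W_{2k}.E.δ` of the census
tables §b03.5 (seven fields) and §b03.29 (fourteen more) are the classes `δ ∈ F^×/Nm_{E/F}(E^×)`, labelled by the `T`-sets
of parts 1–11 [cite: Deligne1982HodgeCycles, §4 (1), Cor. 4.2].  When `E/F` has a RATIONAL radicand — `θ = c²·b₀`,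
`b₀ ∈ ℤ`, i.e. `E = F(√b₀)` is BIQUADRATIC over `ℚ` (fifteen of the twenty-one census fields: `E = F(√-1)`, `F(√-2)`,
`F(√-3)`, `F(√-5)`) — the census column «primes: `[ℓ] ≠ [1] ⟺ ℓ ≡ …`» was derived at tier S (§b03.29 (3)) from the
projection formula for Hilbert symbols.  THIS FILE proves it in the kernel, uniformly in `R`, WITHOUT the projection
formula, from part 12 (`T(ℓ)` is read at an odd place over `ℓ`) and part 13 (degree-one places):

* §32 norms on a quadratic carrier: `2θ + p ∉ ℚ`, `(2θ + p)² = p² - 4q`, **`N_{F/ℚ}(θ - r) = N_{F/ℚ}(-θ - r - p) = R(r)`**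
  (`r ∈ ℤ`; the tree's `norm_quadratic` on the basis `1, 2θ + p`), also in `𝓞_F`.
* §33 **THEOREM (rational prime rule).** Let `ℓ` be an odd prime with `ℓ ∤ (p² - 4q)·b₀`; assume `F` has one dyadic
  place and the odd places dividing `b₀` are harmless (prime to `ℓ`, and `ℓ` a square there or `ord b₀` even).  Then
  **`[ℓ] ≠ [(-1)^k]` (`k` even) ⟺ `p² - 4q` is a square mod `ℓ` AND `b₀` is a non-square mod `ℓ`.**
  (⟹: the odd place `v ∋ ℓ` of part 12 has `b₀` non-square mod `v`, so `N v = ℓ` — at `N v = ℓ²` every integer is a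
  square —, whence `𝓞_F/v = 𝔽_ℓ ∋ (2θ + p)² = p² - 4q`.  ⟸: from `s² ≡ p² - 4q` pick `r ∈ ℤ` with `2r + p ≡ s`,
  `ℓ ∥ R(r)`; then `𝔭 = (ℓ, θ - r)` is a degree-one place with `ord_𝔭 ℓ = 1` (part 13, `(θ - r)(-θ - r - p) = R(r)`)
  at which `b₀` is a non-square: `𝔭 ∈ T(ℓ)`.)
* §34 the two radicands with NO odd place: `b₀ = -1` (`E = F(i)`) and `b₀ = -2` (`E = F(√-2)`), hypotheses discharged.
The instances (fifteen carriers, congruence classes mod `24, 40, 60, 8, 12, 15, 20`) follow in parts 15–16.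
No new definition, no named fact, no sorry; nothing about the Hodge conjecture is asserted.
-/

noncomputable section

set_option linter.dupNamespace false

open Polynomial NumberField IsDedekindDomain

namespace Summit.HodgeConjecture.HodgeConjecture.Ring2.WeilCoverageCM

open Literature.AlgebraicGeometry.Deligne1982
open Literature.AlgebraicGeometry.HodgeTheory (splitDiscriminantClassCM)
open Literature.NumberTheory.QuadraticForms
open Summit.HodgeConjecture.Ring2WeilCoverage.QuarticNormObstruction (norm_quadratic)

variable {R : Polynomial ℤ} [Fact (Irreducible (cmPolyQ R))] [Fact (Irreducible (realPolyQ R))]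

/-! ### §32 Norms on a quadratic carrier `R = S² + pS + q`: `N(θ - r) = N(-θ - r - p) = R(r)` -/

section Norms

variable {p q : ℤ}

omit [Fact (Irreducible (cmPolyQ R))] in
/-- `2θ + p ∉ ℚ` (`{1, θ}` is `ℚ`-free). [cite: Deligne1982HodgeCycles, §4 p. 30] -/
theorem two_mul_root_add_notMem_range (hR : R = X ^ 2 + C p * X + C q) :
    2 * AdjoinRoot.root (realPolyQ R) + (p : realField R) ∉ Set.range (algebraMap ℚ (realField R)) := by
  rintro ⟨s, hs⟩
  rw [eq_ratCast, ← eq_ratCast (AdjoinRoot.of (realPolyQ R))] at hs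
  have h : AdjoinRoot.of (realPolyQ R) ((p : ℚ) - s) + AdjoinRoot.of (realPolyQ R) 2 * AdjoinRoot.root (realPolyQ R) = 0 := by
    rw [map_sub, hs, map_intCast, map_ofNat]; ring
  have h2 := (coords_eq_zero_quadratic hR h).2
  norm_num at h2

omit [Fact (Irreducible (cmPolyQ R))] in
/-- `(2θ + p)² = p² - 4q` in `F`. [cite: Deligne1982HodgeCycles, §4 p. 30] -/
theorem two_mul_root_add_mul_self (hR : R = X ^ 2 + C p * X + C q) :
    (2 * AdjoinRoot.root (realPolyQ R) + (p : realField R)) * (2 * AdjoinRoot.root (realPolyQ R) + (p : realField R)) =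
      algebraMap ℚ (realField R) ((p : ℚ) ^ 2 - 4 * q) := by
  have hrel := root_rel_quadratic hR
  push_cast at hrel
  rw [eq_ratCast]
  push_cast
  linear_combination 4 * hrel

omit [Fact (Irreducible (cmPolyQ R))] in
/-- **`N_{F/ℚ}(θ - r) = r² + pr + q = R(r)`** for `r ∈ ℤ`. [cite: Deligne1982HodgeCycles, §4 p. 30] -/
theorem norm_root_sub_intCast (hR : R = X ^ 2 + C p * X + C q) (r : ℤ) :
    Algebra.norm ℚ (AdjoinRoot.root (realPolyQ R) - (r : realField R)) = (r : ℚ) ^ 2 + p * r + q := by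
  have h2 := finrank_realField_quadratic hR
  have hw := two_mul_root_add_mul_self hR
  have hwF := two_mul_root_add_notMem_range hR
  have hx : AdjoinRoot.root (realPolyQ R) - (r : realField R) =
      algebraMap ℚ (realField R) (-(p : ℚ) / 2 - r) +
        algebraMap ℚ (realField R) (1 / 2) * (2 * AdjoinRoot.root (realPolyQ R) + (p : realField R)) := by
    rw [eq_ratCast, eq_ratCast]
    push_cast
    ring
  rw [hx, norm_quadratic h2 hw hwF]
  ring

omit [Fact (Irreducible (cmPolyQ R))] in
/-- **`N_{F/ℚ}(-θ - r - p) = R(r)`** (the conjugate `θ' = -p - θ`). [cite: Deligne1982HodgeCycles, §4 p. 30] -/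
theorem norm_neg_root_sub_intCast_sub (hR : R = X ^ 2 + C p * X + C q) (r : ℤ) :
    Algebra.norm ℚ (-AdjoinRoot.root (realPolyQ R) - (r : realField R) - (p : realField R)) =
      (r : ℚ) ^ 2 + p * r + q := by
  have h2 := finrank_realField_quadratic hR
  have hw := two_mul_root_add_mul_self hR
  have hwF := two_mul_root_add_notMem_range hR
  have hx : -AdjoinRoot.root (realPolyQ R) - (r : realField R) - (p : realField R) =
      algebraMap ℚ (realField R) (-(p : ℚ) / 2 - r) +
        algebraMap ℚ (realField R) (-1 / 2) * (2 * AdjoinRoot.root (realPolyQ R) + (p : realField R)) := by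
    rw [eq_ratCast, eq_ratCast]
    push_cast
    ring
  rw [hx, norm_quadratic h2 hw hwF]
  ring

omit [Fact (Irreducible (cmPolyQ R))] in
/-- **In `𝓞_F`: `N(θₒ - r) = R(r)`** (`ℤ`-valued norm). [cite: Deligne1982HodgeCycles, §4 p. 30] -/
theorem norm_int_root_sub_intCast (hR : R = X ^ 2 + C p * X + C q) {θₒ : 𝓞 (realField R)}
    (hθ : (θₒ : realField R) = AdjoinRoot.root (realPolyQ R)) (r : ℤ) :
    Algebra.norm ℤ (θₒ - r : 𝓞 (realField R)) = r ^ 2 + p * r + q := by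
  have h := Algebra.coe_norm_int (θₒ - r : 𝓞 (realField R))
  have e : ((θₒ - r : 𝓞 (realField R)) : realField R) = AdjoinRoot.root (realPolyQ R) - (r : realField R) := by
    rw [← hθ, show ((θₒ - r : 𝓞 (realField R)) : realField R) =
      algebraMap (𝓞 (realField R)) (realField R) (θₒ - r) from rfl, map_sub, map_intCast]
  rw [e, norm_root_sub_intCast hR r] at h
  exact_mod_cast h

omit [Fact (Irreducible (cmPolyQ R))] in
/-- **In `𝓞_F`: `N(-θₒ - r - p) = R(r)`.** [cite: Deligne1982HodgeCycles, §4 p. 30] -/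
theorem norm_int_neg_root_sub_intCast_sub (hR : R = X ^ 2 + C p * X + C q) {θₒ : 𝓞 (realField R)}
    (hθ : (θₒ : realField R) = AdjoinRoot.root (realPolyQ R)) (r : ℤ) :
    Algebra.norm ℤ (-θₒ - r - p : 𝓞 (realField R)) = r ^ 2 + p * r + q := by
  have h := Algebra.coe_norm_int (-θₒ - r - p : 𝓞 (realField R))
  have e : ((-θₒ - r - p : 𝓞 (realField R)) : realField R) =
      -AdjoinRoot.root (realPolyQ R) - (r : realField R) - (p : realField R) := by
    rw [← hθ, show ((-θₒ - r - p : 𝓞 (realField R)) : realField R) =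
      algebraMap (𝓞 (realField R)) (realField R) (-θₒ - r - p) from rfl, map_sub, map_sub, map_neg, map_intCast,
      map_intCast]
  rw [e, norm_neg_root_sub_intCast_sub hR r] at h
  exact_mod_cast h

/-- **A root of `R` mod `ℓ` with `ℓ ∥ R(r)`** from a square root `s` of the discriminant mod an odd prime `ℓ ∤ p² - 4q`:
some `r ∈ ℤ` has `2r + p ≡ s`, `ℓ ∣ R(r)`, `ℓ² ∤ R(r)` (`4R(r) = (2r+p)² - (p² - 4q)`; replace `r` by `r + ℓ` if
`ℓ² ∣ R(r)`). [folklore] -/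
theorem exists_root_mod_of_sq_sub_disc_dvd {ℓ : ℕ} (hℓ : ℓ.Prime) (hℓ2 : ℓ ≠ 2) (hdisc : ¬ (ℓ : ℤ) ∣ p ^ 2 - 4 * q)
    {s : ℤ} (hs : (ℓ : ℤ) ∣ s * s - (p ^ 2 - 4 * q)) :
    ∃ r : ℤ, (ℓ : ℤ) ∣ 2 * r + p - s ∧ (ℓ : ℤ) ∣ r ^ 2 + p * r + q ∧ ¬ ((ℓ : ℤ) ^ 2 ∣ r ^ 2 + p * r + q) := by
  have hℓZ : Prime (ℓ : ℤ) := Nat.prime_iff_prime_int.1 hℓ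
  obtain ⟨m, hm⟩ := hℓ.eq_two_or_odd'.resolve_left hℓ2
  -- every `r` with `2r + p ≡ s` is a root of `R` mod `ℓ`
  have key : ∀ r : ℤ, (ℓ : ℤ) ∣ 2 * r + p - s → (ℓ : ℤ) ∣ r ^ 2 + p * r + q := by
    intro r hr
    have h4 : (ℓ : ℤ) ∣ 4 * (r ^ 2 + p * r + q) := by
      have e : 4 * (r ^ 2 + p * r + q) = (2 * r + p - s) * (2 * r + p + s) + (s * s - (p ^ 2 - 4 * q)) := by ring
      rw [e]; exact dvd_add (dvd_mul_of_dvd_left hr _) hs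
    refine (hℓZ.dvd_or_dvd h4).resolve_left fun h ↦ ?_
    have h' : (ℓ : ℤ) ∣ 2 * 2 := by simpa using h
    have h2le := hℓ.two_le
    rcases hℓZ.dvd_or_dvd h' with h2 | h2 <;>
    · have := Int.le_of_dvd (by norm_num) h2; omega
  -- and `2r + p` is then prime to `ℓ` (`ℓ ∤ s`, as `ℓ ∤ disc`)
  have hs0 : ¬ (ℓ : ℤ) ∣ s := fun h ↦ hdisc (by
    have : (ℓ : ℤ) ∣ s * s - (s * s - (p ^ 2 - 4 * q)) := dvd_sub (dvd_mul_of_dvd_left h _) hs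
    simpa using this)
  have hunit : ∀ r : ℤ, (ℓ : ℤ) ∣ 2 * r + p - s → ¬ (ℓ : ℤ) ∣ 2 * r + p := fun r hr h ↦ hs0 (by
    have := dvd_sub h hr; simpa using this)
  set r₁ : ℤ := (m + 1) * (s - p) with hr₁
  have h1 : (ℓ : ℤ) ∣ 2 * r₁ + p - s := ⟨s - p, by rw [hr₁, hm]; push_cast; ring⟩
  by_cases hsq : (ℓ : ℤ) ^ 2 ∣ r₁ ^ 2 + p * r₁ + q
  · have h2 : (ℓ : ℤ) ∣ 2 * (r₁ + ℓ) + p - s := by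
      have e : 2 * (r₁ + ℓ) + p - s = (2 * r₁ + p - s) + ℓ * 2 := by ring
      rw [e]; exact dvd_add h1 (dvd_mul_right _ _)
    refine ⟨r₁ + ℓ, h2, key _ h2, fun hsq' ↦ hunit r₁ h1 ?_⟩
    have e : (r₁ + ℓ) ^ 2 + p * (r₁ + ℓ) + q = (r₁ ^ 2 + p * r₁ + q) + ℓ * (2 * r₁ + p + ℓ) := by ring
    rw [e] at hsq'
    have h3 : (ℓ : ℤ) ^ 2 ∣ ℓ * (2 * r₁ + p + ℓ) := (dvd_add_right hsq).1 hsq'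
    rw [sq] at h3
    have h4 : (ℓ : ℤ) ∣ 2 * r₁ + p + ℓ := (mul_dvd_mul_iff_left hℓZ.ne_zero).1 h3
    exact (dvd_add_left (dvd_refl _)).1 h4
  · exact ⟨r₁, h1, key _ h1, hsq⟩

end Norms

/-! ### §33 THE RATIONAL PRIME RULE on a quadratic carrier with a rational radicand -/

/-- **THEOREM (rational prime rule, quadratic carrier, rational radicand).** `R = S² + pS + q`, `θ = c²·b₀` with
`b₀ ∈ ℤ` (`E = F(√b₀)`), `F` with ONE dyadic place, the odd places dividing `b₀` harmless for `ℓ`; `ℓ` an odd prime,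
`ℓ ∤ p² - 4q`, `ℓ ∤ b₀`.  Then **`[ℓ] ≠ [(-1)^k]` (`k` even) iff `p² - 4q` is a square mod `ℓ` and `b₀` is a
non-square mod `ℓ`** — «`ℓ` splits in `F = ℚ(√(p² - 4q))` into two (degree-one, unramified) places INERT in
`E = F(√b₀)`». [cite: Deligne1982HodgeCycles, §4 (1) and Cor. 4.2] [cite: Omeara1963, §63B Example 63:12 and
§71D Thm. 71:18] -/
theorem mk_natCast_ne_splitDiscriminantClassCM_iff_isSquare_disc {p q : ℤ} (hR : R = X ^ 2 + C p * X + C q)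
    (hroots : ∀ s : ℂ, Polynomial.eval₂ (Int.castRingHom ℂ) s R = 0 → s.im = 0 ∧ s.re < 0)
    {θₒ : 𝓞 (realField R)} (hθ : (θₒ : realField R) = AdjoinRoot.root (realPolyQ R))
    {c : realField R} {b₀ : ℤ}
    (hfac : AdjoinRoot.root (realPolyQ R) = c ^ 2 * ((b₀ : 𝓞 (realField R)) : realField R))
    (huniq : ∀ v v' : HeightOneSpectrum (𝓞 (realField R)),
      (2 : 𝓞 (realField R)) ∈ v.asIdeal → (2 : 𝓞 (realField R)) ∈ v'.asIdeal → v = v')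
    {ℓ : ℕ} (hℓ : ℓ.Prime) (hℓ2 : ℓ ≠ 2) (hdisc : ¬ (ℓ : ℤ) ∣ p ^ 2 - 4 * q) (hℓb : ¬ (ℓ : ℤ) ∣ b₀)
    (hb : ∀ v : HeightOneSpectrum (𝓞 (realField R)), (2 : 𝓞 (realField R)) ∉ v.asIdeal →
      (b₀ : 𝓞 (realField R)) ∈ v.asIdeal →
        (ℓ : 𝓞 (realField R)) ∉ v.asIdeal ∧
          (IsSquare (Ideal.Quotient.mk v.asIdeal (ℓ : 𝓞 (realField R))) ∨
            ¬ Odd (WithZero.log (v.valuation (realField R) ((b₀ : 𝓞 (realField R)) : realField R)))))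
    (qℓ : (realField R)ˣ) (hq : (qℓ : realField R) = ℓ) {k : ℕ} (hk : Even k) :
    (QuotientGroup.mk qℓ : cmNormResidueGroup R) ≠ splitDiscriminantClassCM R k ↔
      IsSquare ((p ^ 2 - 4 * q : ℤ) : ZMod ℓ) ∧ ¬ IsSquare ((b₀ : ℤ) : ZMod ℓ) := by
  have hK := finrank_realField_quadratic hR
  have hrel := ringOfIntegers_root_rel_quadratic hR hθ
  have hℓZ : Prime (ℓ : ℤ) := Nat.prime_iff_prime_int.1 hℓ
  rw [mk_natCast_ne_splitDiscriminantClassCM_iff hroots hfac huniq hℓ hb qℓ hq hk]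
  constructor
  · rintro ⟨v, -, -, hns, hodd⟩
    have hℓv : (ℓ : 𝓞 (realField R)) ∈ v.asIdeal := natCast_mem_of_odd_log_valuation v hodd
    -- `N v = ℓ`: at `N v = ℓ²` every integer would be a square
    have hN : Ideal.absNorm v.asIdeal = ℓ := by
      rcases absNorm_eq_or_eq_sq_of_natCast_mem hK v hℓ hℓv with h | h
      · exact h
      · exact absurd (isSquare_intCast_residue_of_absNorm_eq_sq v hℓ h b₀) hns
    refine ⟨?_, fun hsq ↦ hns ((isSquare_intCast_residue_iff_of_absNorm_eq v hℓ hN b₀).2 hsq)⟩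
    have hsqO : ((p ^ 2 - 4 * q : ℤ) : 𝓞 (realField R)) = (2 * θₒ + p) * (2 * θₒ + p) := by
      push_cast; linear_combination (-4 : 𝓞 (realField R)) * hrel
    rw [← isSquare_intCast_residue_iff_of_absNorm_eq v hℓ hN]
    exact ⟨Ideal.Quotient.mk v.asIdeal (2 * θₒ + p), by rw [← map_mul, ← hsqO]⟩
  · rintro ⟨hdsq, hbns⟩
    -- a square root `s` of the discriminant mod `ℓ`, a root `r` of `R` mod `ℓ` with `ℓ ∥ R(r)`
    obtain ⟨s₀, hs₀⟩ := hdsq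
    obtain ⟨s, rfl⟩ := ZMod.intCast_surjective s₀
    have hsd : (ℓ : ℤ) ∣ s * s - (p ^ 2 - 4 * q) := by
      rw [← ZMod.intCast_zmod_eq_zero_iff_dvd]; push_cast; rw [← hs₀]; push_cast; ring
    obtain ⟨r, hrs, hR1, hR2⟩ := exists_root_mod_of_sq_sub_disc_dvd hℓ hℓ2 hdisc hsd
    obtain ⟨m₁, hm₁⟩ := hR1
    have hm₁ℓ : ¬ (ℓ : ℤ) ∣ m₁ := fun h ↦ hR2 (by rw [hm₁, sq]; exact mul_dvd_mul_left _ h)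
    have h2rp : ¬ (ℓ : ℤ) ∣ 2 * r + p := fun h ↦ hdisc (by
      have e : p ^ 2 - 4 * q = (2 * r + p) * (2 * r + p) - 4 * (r ^ 2 + p * r + q) := by ring
      rw [e, hm₁]
      exact dvd_sub (dvd_mul_of_dvd_left h _) (Dvd.dvd.mul_left (dvd_mul_right _ _) _))
    -- the elements `x = θₒ - r`, `x' = -θₒ - r - p` of `𝓞_F`: `x x' = R(r) = ℓ m₁`, norms `R(r)`
    set x : 𝓞 (realField R) := θₒ - r with hx
    set x' : 𝓞 (realField R) := -θₒ - r - p with hx'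
    have hxx' : x * x' = ℓ * m₁ := by
      have e : ((ℓ : ℤ) : 𝓞 (realField R)) * (m₁ : 𝓞 (realField R)) = ((r ^ 2 + p * r + q : ℤ) : 𝓞 (realField R)) := by
        rw [hm₁]; push_cast; ring
      rw [hx, hx', show (ℓ : 𝓞 (realField R)) = ((ℓ : ℤ) : 𝓞 (realField R)) by push_cast; rfl, e]
      push_cast
      linear_combination (-1 : 𝓞 (realField R)) * hrel
    have hNx : (Algebra.norm ℤ x).natAbs = ℓ * m₁.natAbs := by
      rw [hx, norm_int_root_sub_intCast hR hθ r, hm₁, Int.natAbs_mul, Int.natAbs_natCast]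
    have hNx' : ¬ ((ℓ : ℤ) ^ 2) ∣ Algebra.norm ℤ x' := by
      rw [hx', norm_int_neg_root_sub_intCast_sub hR hθ r]; exact hR2
    have hm₁' : ¬ ℓ ∣ m₁.natAbs := fun h ↦ hm₁ℓ (Int.natCast_dvd.2 h)
    -- the degree-one place `𝔭 = (ℓ, x)`
    obtain ⟨v, hv, hNv, hℓv, hxv⟩ := exists_place_absNorm_eq_of_norm hK hℓ hxx' hNx' hNx hm₁'
    have hℓv' : ((ℓ : ℤ) : 𝓞 (realField R)) ∈ v.asIdeal := by push_cast; exact hℓv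
    have h2rpv : ((2 * r + p : ℤ) : 𝓞 (realField R)) ∉ v.asIdeal :=
      intCast_notMem_of_isCoprime v ((Prime.coprime_iff_not_dvd hℓZ).2 h2rp) hℓv'
    have hx'v : x' ∉ v.asIdeal := fun h ↦ h2rpv (by
      have e : ((2 * r + p : ℤ) : 𝓞 (realField R)) = -x - x' := by rw [hx, hx']; push_cast; ring
      rw [e]; exact v.asIdeal.sub_mem (v.asIdeal.neg_mem hxv) h)
    have hm₁v : (m₁ : 𝓞 (realField R)) ∉ v.asIdeal :=
      intCast_notMem_of_isCoprime v ((Prime.coprime_iff_not_dvd hℓZ).2 hm₁ℓ) hℓv'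
    have hord := intValuation_natCast_eq_exp_neg_one_of_place v hv hxx' hx'v hm₁v
    refine ⟨v, ?_, ?_, fun hsq ↦ hbns ((isSquare_intCast_residue_iff_of_absNorm_eq v hℓ hNv b₀).1 hsq), ?_⟩
    · -- `2 ∉ v` (`ℓ` odd)
      have h2 : ¬ (ℓ : ℤ) ∣ 2 := fun h ↦ by
        have := Int.le_of_dvd (by norm_num) h
        have h1 := hℓ.two_le
        omega
      have := intCast_notMem_of_isCoprime v ((Prime.coprime_iff_not_dvd hℓZ).2 h2) hℓv'
      push_cast at this
      exact this
    · exact intCast_notMem_of_isCoprime v ((Prime.coprime_iff_not_dvd hℓZ).2 hℓb) hℓv'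
    · rw [show (ℓ : realField R) = algebraMap (𝓞 (realField R)) (realField R) (ℓ : 𝓞 (realField R)) by
        rw [map_natCast], HeightOneSpectrum.valuation_of_algebraMap, hord, WithZero.log_exp]
      decide

/-! ### §34 The radicands with no odd place: `E = F(√-1)` and `E = F(√-2)` -/

/-- **`E = F(√-1)` (`θ = -c²`: `ℚ(ζ₈) = ℚ(i,√2)`, `ℚ(ζ₁₂) = ℚ(i,√3)`, `ℚ(i,√5)`, `ℚ(i,√6)`, `ℚ(i,√10)`, `ℚ(i,√15)`):
for every odd prime `ℓ ∤ p² - 4q`, `[ℓ] ≠ [(-1)^k]` iff `p² - 4q` is a square and `-1` a non-square mod `ℓ`**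
(`F` with one dyadic place). [cite: Deligne1982HodgeCycles, §4 (1) and Cor. 4.2] [cite: Omeara1963, §71D Thm. 71:18] -/
theorem mk_natCast_ne_splitDiscriminantClassCM_iff_of_root_eq_neg_sq {p q : ℤ} (hR : R = X ^ 2 + C p * X + C q)
    (hroots : ∀ s : ℂ, Polynomial.eval₂ (Int.castRingHom ℂ) s R = 0 → s.im = 0 ∧ s.re < 0)
    {θₒ : 𝓞 (realField R)} (hθ : (θₒ : realField R) = AdjoinRoot.root (realPolyQ R))
    {c : realField R} (hfac : AdjoinRoot.root (realPolyQ R) = -c ^ 2)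
    (huniq : ∀ v v' : HeightOneSpectrum (𝓞 (realField R)),
      (2 : 𝓞 (realField R)) ∈ v.asIdeal → (2 : 𝓞 (realField R)) ∈ v'.asIdeal → v = v')
    {ℓ : ℕ} (hℓ : ℓ.Prime) (hℓ2 : ℓ ≠ 2) (hdisc : ¬ (ℓ : ℤ) ∣ p ^ 2 - 4 * q)
    (qℓ : (realField R)ˣ) (hq : (qℓ : realField R) = ℓ) {k : ℕ} (hk : Even k) :
    (QuotientGroup.mk qℓ : cmNormResidueGroup R) ≠ splitDiscriminantClassCM R k ↔
      IsSquare ((p ^ 2 - 4 * q : ℤ) : ZMod ℓ) ∧ ¬ IsSquare (-1 : ZMod ℓ) := by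
  have hfac' : AdjoinRoot.root (realPolyQ R) = c ^ 2 * (((-1 : ℤ) : 𝓞 (realField R)) : realField R) := by
    rw [hfac, show (((-1 : ℤ) : 𝓞 (realField R)) : realField R) = ((-1 : ℤ) : realField R) from
      map_intCast (algebraMap (𝓞 (realField R)) (realField R)) _]
    push_cast; ring
  have hℓb : ¬ (ℓ : ℤ) ∣ (-1 : ℤ) := fun h ↦ by
    have := Int.le_of_dvd (by norm_num) ((dvd_neg).1 h)
    have := hℓ.two_le
    omega
  have hb : ∀ v : HeightOneSpectrum (𝓞 (realField R)), (2 : 𝓞 (realField R)) ∉ v.asIdeal →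
      ((-1 : ℤ) : 𝓞 (realField R)) ∈ v.asIdeal →
        (ℓ : 𝓞 (realField R)) ∉ v.asIdeal ∧
          (IsSquare (Ideal.Quotient.mk v.asIdeal (ℓ : 𝓞 (realField R))) ∨
            ¬ Odd (WithZero.log (v.valuation (realField R) (((-1 : ℤ) : 𝓞 (realField R)) : realField R)))) := by
    intro v _ h1
    exfalso
    refine v.isPrime.ne_top ((Ideal.eq_top_iff_one _).2 ?_)
    have := v.asIdeal.neg_mem h1
    push_cast at this
    simpa using this
  rw [mk_natCast_ne_splitDiscriminantClassCM_iff_isSquare_disc hR hroots hθ hfac' huniq hℓ hℓ2 hdisc hℓb hb qℓ hq hk]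
  push_cast
  exact Iff.rfl

/-- **`E = F(√-2)` (`θ = -2c²`: `ℚ(√-2,√3)`, `ℚ(√-2,√-3)`, `ℚ(√-2,√5)`, `ℚ(√-2,√-5)`, `ℚ(√-(2+√2)) ∌ √-2` excluded):
for every odd prime `ℓ ∤ p² - 4q`, `[ℓ] ≠ [(-1)^k]` iff `p² - 4q` is a square and `-2` a non-square mod `ℓ`.**
[cite: Deligne1982HodgeCycles, §4 (1) and Cor. 4.2] [cite: Omeara1963, §71D Thm. 71:18] -/
theorem mk_natCast_ne_splitDiscriminantClassCM_iff_of_root_eq_neg_two_mul_sq {p q : ℤ}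
    (hR : R = X ^ 2 + C p * X + C q)
    (hroots : ∀ s : ℂ, Polynomial.eval₂ (Int.castRingHom ℂ) s R = 0 → s.im = 0 ∧ s.re < 0)
    {θₒ : 𝓞 (realField R)} (hθ : (θₒ : realField R) = AdjoinRoot.root (realPolyQ R))
    {c : realField R} (hfac : AdjoinRoot.root (realPolyQ R) = -2 * c ^ 2)
    (huniq : ∀ v v' : HeightOneSpectrum (𝓞 (realField R)),
      (2 : 𝓞 (realField R)) ∈ v.asIdeal → (2 : 𝓞 (realField R)) ∈ v'.asIdeal → v = v')
    {ℓ : ℕ} (hℓ : ℓ.Prime) (hℓ2 : ℓ ≠ 2) (hdisc : ¬ (ℓ : ℤ) ∣ p ^ 2 - 4 * q)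
    (qℓ : (realField R)ˣ) (hq : (qℓ : realField R) = ℓ) {k : ℕ} (hk : Even k) :
    (QuotientGroup.mk qℓ : cmNormResidueGroup R) ≠ splitDiscriminantClassCM R k ↔
      IsSquare ((p ^ 2 - 4 * q : ℤ) : ZMod ℓ) ∧ ¬ IsSquare (-2 : ZMod ℓ) := by
  have hfac' : AdjoinRoot.root (realPolyQ R) = c ^ 2 * (((-2 : ℤ) : 𝓞 (realField R)) : realField R) := by
    rw [hfac, show (((-2 : ℤ) : 𝓞 (realField R)) : realField R) = ((-2 : ℤ) : realField R) from
      map_intCast (algebraMap (𝓞 (realField R)) (realField R)) _]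
    push_cast; ring
  have hℓb : ¬ (ℓ : ℤ) ∣ (-2 : ℤ) := fun h ↦ by
    have := Int.le_of_dvd (by norm_num) ((dvd_neg).1 h)
    have := hℓ.two_le
    omega
  have hb : ∀ v : HeightOneSpectrum (𝓞 (realField R)), (2 : 𝓞 (realField R)) ∉ v.asIdeal →
      ((-2 : ℤ) : 𝓞 (realField R)) ∈ v.asIdeal →
        (ℓ : 𝓞 (realField R)) ∉ v.asIdeal ∧
          (IsSquare (Ideal.Quotient.mk v.asIdeal (ℓ : 𝓞 (realField R))) ∨
            ¬ Odd (WithZero.log (v.valuation (realField R) (((-2 : ℤ) : 𝓞 (realField R)) : realField R)))) := by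
    intro v h2 h1
    exfalso
    apply h2
    have := v.asIdeal.neg_mem h1
    push_cast at this
    simpa using this
  rw [mk_natCast_ne_splitDiscriminantClassCM_iff_isSquare_disc hR hroots hθ hfac' huniq hℓ hℓ2 hdisc hℓb hb qℓ hq hk]
  push_cast
  exact Iff.rfl

end Summit.HodgeConjecture.HodgeConjecture.Ring2.WeilCoverageCM

end
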